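import Mathlib
import Literature.Analysis.ODE.IntegralGronwall
import Literature.Analysis.FluidPDE.VectorCalculus
import HarnessLib

/-!
# Flux duality bookkeeping (backward Grönwall + constant pairing)

Stub `stub_clockFluxDuality` of the line `Sketch` (ideator-4 `flux-weighted-stretching-clock`) for
the crux `Theses.RecurrentProfiles.RecurrentLiouville` (stmt-NavierStokesRegularity-1589): the K3
bookkeeping step, pure real analysis.  On a window `[t₀, t₁]` let `m > 0`, `b ≥ 0` be continuous,
let `P` be constant on the window with `|P t₀| ≤ A₀ m t₀` and `P t₁ ≠ 0`, and let the backward mass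
inequality `m s ≤ m t₁ + ∫_s^{t₁} b` hold for every `s ∈ [t₀, t₁]`.  Then
`log (|P t₁| / (A₀ m t₁)) ≤ ∫_{t₀}^{t₁} b / m`.

Proof: with the continuous coefficient `a = b / m ≥ 0` the mass inequality reads
`m s ≤ m t₁ + ∫_s^{t₁} a m`; after the time reversal `τ = t₁ - t` this is the hypothesis of the
integral Grönwall inequality `Literature.Analysis.ODE.gronwall_integral_le` (constant `h ≡ m t₁`),
whence `m t₀ ≤ m t₁ exp ∫_{t₀}^{t₁} b / m`; the functions, only continuous on the window, are first
extended to `ℝ` by clamping the argument to `[t₀, t₁]`.  Finally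
`|P t₁| = |P t₀| ≤ A₀ m t₀ ≤ A₀ m t₁ exp ∫ b / m` and `A₀ > 0`.

* `clockFlux_reversed_gronwall` — backward Grönwall for globally continuous data.
* `clockFlux_backward_gronwall` — backward Grönwall for data continuous on the window.
* `stub_clockFluxDuality` — the registered stub.
-/

noncomputable section

set_option linter.dupNamespace false

namespace Summit.NavierStokesRegularity.NavierStokesRegularity.Theorems

open MeasureTheory Set Function Filter Topology TopologicalSpace Metric
open Literature.Analysis Literature.Analysis.FluidPDE
open scoped NNReal ENNReal RealInnerProductSpace Laplacian

/-- **Backward Grönwall, globally continuous data.**  If `M, a : ℝ → ℝ` are continuous, `a ≥ 0`,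
and `M s ≤ M t₁ + ∫_s^{t₁} a M` for every `s ∈ [t₀, t₁]` (`t₀ ≤ t₁`), then
`M t₀ ≤ M t₁ exp ∫_{t₀}^{t₁} a`.  Time reversal `τ = t₁ - t` of
`Literature.Analysis.ODE.gronwall_integral_le` with the constant comparison function `h ≡ M t₁`. -/
theorem clockFlux_reversed_gronwall {t₀ t₁ : ℝ} (h01 : t₀ ≤ t₁) {M a : ℝ → ℝ}
    (hM : Continuous M) (ha : Continuous a) (ha0 : ∀ t, 0 ≤ a t)
    (hmass : ∀ s ∈ Icc t₀ t₁, M s ≤ M t₁ + ∫ t in s..t₁, a t * M t) :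
    M t₀ ≤ M t₁ * Real.exp (∫ t in t₀..t₁, a t) := by
  have hT : 0 ≤ t₁ - t₀ := sub_nonneg.2 h01
  have hrev : Continuous fun τ : ℝ => t₁ - τ := continuous_const.sub continuous_id
  have hαc : Continuous fun τ => a (t₁ - τ) := ha.comp hrev
  have hgc : Continuous fun τ => M (t₁ - τ) := hM.comp hrev
  have hα0 : ∀ τ, 0 ≤ a (t₁ - τ) := fun τ => ha0 _
  have hle : ∀ τ ∈ Icc 0 (t₁ - t₀),
      M (t₁ - τ) ≤ M t₁ + ∫ σ in (0:ℝ)..τ, a (t₁ - σ) * M (t₁ - σ) := by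
    intro τ hτ
    have hsτ : t₁ - τ ∈ Icc t₀ t₁ := ⟨by linarith [hτ.2], by linarith [hτ.1]⟩
    have h3 : ∫ σ in (0:ℝ)..τ, (a * M) (t₁ - σ) = ∫ t in (t₁ - τ)..(t₁ - 0), (a * M) t :=
      intervalIntegral.integral_comp_sub_left (a * M) t₁
    simp only [Pi.mul_apply, sub_zero] at h3
    rw [h3]
    exact hmass _ hsτ
  have hG := Literature.Analysis.ODE.gronwall_integral_le (a := fun τ => a (t₁ - τ))
    (g := fun τ => M (t₁ - τ)) (h := fun _ => M t₁) hT hαc hgc hα0 monotoneOn_const hle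
  have h4 : ∫ σ in (0:ℝ)..(t₁ - t₀), a (t₁ - σ) = ∫ t in (t₁ - (t₁ - t₀))..(t₁ - 0), a t :=
    intervalIntegral.integral_comp_sub_left a t₁
  rw [h4] at hG
  simpa only [sub_sub_cancel, sub_zero] using hG

/-- **Backward Grönwall on a window.**  If `m, b` are continuous on `[t₀, t₁]` (`t₀ ≤ t₁`) with
`m > 0`, `b ≥ 0` there, and `m s ≤ m t₁ + ∫_s^{t₁} b` for every `s ∈ [t₀, t₁]`, then
`m t₀ ≤ m t₁ exp ∫_{t₀}^{t₁} b / m`.  Reduction to `clockFlux_reversed_gronwall`: extend `m`, `b` to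
`ℝ` by clamping the argument to the window (`t ↦ max t₀ (min t t₁)`) and take `a = b / m`. -/
theorem clockFlux_backward_gronwall {t₀ t₁ : ℝ} (h01 : t₀ ≤ t₁) {m b : ℝ → ℝ}
    (hm : ContinuousOn m (Icc t₀ t₁)) (hb : ContinuousOn b (Icc t₀ t₁))
    (hb0 : ∀ t ∈ Icc t₀ t₁, 0 ≤ b t) (hm0 : ∀ t ∈ Icc t₀ t₁, 0 < m t)
    (hmass : ∀ s ∈ Icc t₀ t₁, m s ≤ m t₁ + ∫ t in s..t₁, b t) :
    m t₀ ≤ m t₁ * Real.exp (∫ t in t₀..t₁, b t / m t) := by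
  -- the clamp `t ↦ max t₀ (min t t₁)` onto the window
  have hc_mem : ∀ t, max t₀ (min t t₁) ∈ Icc t₀ t₁ := fun t =>
    ⟨le_max_left _ _, max_le h01 (min_le_right _ _)⟩
  have hc_id : ∀ t ∈ Icc t₀ t₁, max t₀ (min t t₁) = t := fun t ht => by
    rw [min_eq_left ht.2, max_eq_right ht.1]
  have hcc : Continuous fun t : ℝ => max t₀ (min t t₁) := by fun_prop
  have hMc : Continuous fun t => m (max t₀ (min t t₁)) := hm.comp_continuous hcc hc_mem
  have hBc : Continuous fun t => b (max t₀ (min t t₁)) := hb.comp_continuous hcc hc_mem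
  have hM0 : ∀ t, 0 < m (max t₀ (min t t₁)) := fun t => hm0 _ (hc_mem t)
  have hac : Continuous fun t => b (max t₀ (min t t₁)) / m (max t₀ (min t t₁)) :=
    hBc.div hMc fun t => (hM0 t).ne'
  have ha0 : ∀ t, 0 ≤ b (max t₀ (min t t₁)) / m (max t₀ (min t t₁)) := fun t =>
    div_nonneg (hb0 _ (hc_mem t)) (hM0 t).le
  have hle : ∀ s ∈ Icc t₀ t₁, m (max t₀ (min s t₁)) ≤ m (max t₀ (min t₁ t₁)) +
      ∫ t in s..t₁, b (max t₀ (min t t₁)) / m (max t₀ (min t t₁)) * m (max t₀ (min t t₁)) := by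
    intro s hs
    have h1 : ∫ t in s..t₁, b (max t₀ (min t t₁)) / m (max t₀ (min t t₁)) * m (max t₀ (min t t₁))
        = ∫ t in s..t₁, b t := by
      refine intervalIntegral.integral_congr fun t ht => ?_
      rw [uIcc_of_le hs.2] at ht
      have ht' : t ∈ Icc t₀ t₁ := ⟨hs.1.trans ht.1, ht.2⟩
      simp only [hc_id t ht']
      exact div_mul_cancel₀ _ (hm0 t ht').ne'
    rw [hc_id s hs, hc_id t₁ (right_mem_Icc.2 h01), h1]
    exact hmass s hs
  have key := clockFlux_reversed_gronwall (M := fun t => m (max t₀ (min t t₁)))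
    (a := fun t => b (max t₀ (min t t₁)) / m (max t₀ (min t t₁))) h01 hMc hac ha0 hle
  have hI : ∫ t in t₀..t₁, b (max t₀ (min t t₁)) / m (max t₀ (min t t₁))
      = ∫ t in t₀..t₁, b t / m t := by
    refine intervalIntegral.integral_congr fun t ht => ?_
    rw [uIcc_of_le h01] at ht
    simp only [hc_id t ht]
  simpa only [hc_id t₀ (left_mem_Icc.2 h01), hc_id t₁ (right_mem_Icc.2 h01), hI] using key

/-- **Flux duality bookkeeping** (registered stub of the line `Sketch`, pure real analysis).  On a
window `[t₀, t₁]` let `m > 0` (the adjoint mass) and `b ≥ 0` (the weighted strain) be continuous,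
let the pairing `P` be constant on the window with `|P t₀| ≤ A₀ m t₀` and `P t₁ ≠ 0`, and let the
mass inequality `m s ≤ m t₁ + ∫_s^{t₁} b` hold for every `s ∈ [t₀, t₁]`.  Then
`log (|P t₁| / (A₀ m t₁)) ≤ ∫_{t₀}^{t₁} b / m`: backward Grönwall
(`clockFlux_backward_gronwall`) gives `m t₀ ≤ m t₁ exp ∫ b / m`, and
`|P t₁| = |P t₀| ≤ A₀ m t₀` forces `A₀ > 0`. -/
theorem stub_clockFluxDuality :
    ∀ (t₀ t₁ : ℝ), t₀ < t₁ → ∀ (m b P : ℝ → ℝ) (A₀ : ℝ),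
      ContinuousOn m (Set.Icc t₀ t₁) → ContinuousOn b (Set.Icc t₀ t₁) →
      (∀ t ∈ Set.Icc t₀ t₁, 0 ≤ b t) → (∀ t ∈ Set.Icc t₀ t₁, 0 < m t) →
      (∀ s ∈ Set.Icc t₀ t₁, P s = P t₁) →
      |P t₀| ≤ A₀ * m t₀ →
      (∀ s ∈ Set.Icc t₀ t₁, m s ≤ m t₁ + ∫ t in s..t₁, b t) →
      0 < |P t₁| →
      Real.log (|P t₁| / (A₀ * m t₁)) ≤ ∫ t in t₀..t₁, b t / m t := by
  intro t₀ t₁ h01 m b P A₀ hm hb hb0 hm0 hP hA hmass hP1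
  have hG := clockFlux_backward_gronwall h01.le hm hb hb0 hm0 hmass
  have hm0' : 0 < m t₀ := hm0 t₀ (left_mem_Icc.2 h01.le)
  have hm1' : 0 < m t₁ := hm0 t₁ (right_mem_Icc.2 h01.le)
  have hP0 : |P t₀| = |P t₁| := by rw [hP t₀ (left_mem_Icc.2 h01.le)]
  have hprod : 0 < A₀ * m t₀ := hP1.trans_le (hP0 ▸ hA)
  have hA0 : 0 < A₀ := (pos_iff_pos_of_mul_pos hprod).2 hm0'
  have hden : 0 < A₀ * m t₁ := mul_pos hA0 hm1'
  rw [Real.log_le_iff_le_exp (div_pos hP1 hden), div_le_iff₀ hden]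
  calc |P t₁| = |P t₀| := hP0.symm
    _ ≤ A₀ * m t₀ := hA
    _ ≤ A₀ * (m t₁ * Real.exp (∫ t in t₀..t₁, b t / m t)) := mul_le_mul_of_nonneg_left hG hA0.le
    _ = Real.exp (∫ t in t₀..t₁, b t / m t) * (A₀ * m t₁) := by ring

end Summit.NavierStokesRegularity.NavierStokesRegularity.Theorems

end
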